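import Summits.QuantumFields.YangMills.Theorems.BalabanUVNodesN08AlphaLoop28
import Summits.QuantumFields.Balaban3D.Proofs.Thresholds
import Summits.QuantumFields.Balaban3D.Proofs.LargeFieldStd

/-!
# Route «BalabanUVNodes», Track-A DAG node N08 = [Balaban1985UV3] — THE (α) CLAUSE, CLASS-I ROW `h44`: the displayed smallness `LoopSmall`
# of `BalabanUVNodesN08AlphaLoop28` («for g_{k−1} sufficiently small», p. 267 L7–8) DISCHARGED FROM ONE COUPLING THRESHOLD `g_k ≤ γ_loop`

Cell `pub-ymgap`, seat `pub-ymgap-dag-n08-d` gen 2 (v1.1 of the located item L1); `bears_on: R4∕N08`; filed `--supports stmt-QuantumFields-19674`.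
Sorry-free, standard axioms.  Two closed-form constants (`sigmaLoop`, `gammaLoop`) and theorems.

WHAT THIS FILE DOES.  `BalabanUVNodesN08AlphaLoop28.loop28_of_reg2` derives (44)'s loop input from the face `reg2` under THREE displayed
smallness clauses `LoopSmall 𝔊 𝔠` on the lane's objects ([4] Prop. 2's `C₀α₀ ≤ ⅓`, `2α₀ ≤ c₂′(3, L)` for `α₀ = C68·g_kp(g_k)`, and the radius
clause `Rcol j · 2C68 g_kp(g_k)·ℓ_j² ≤ ½`, `1 ≤ j ≤ k`).  Here they follow from ONE threshold on the running coupling, `g_k ≤ γ_loop(𝔠, L)`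
for `k < K` (`loopSmall_of_le_gammaLoop`), by the lane's E2 arithmetic BY NAME: `Thresholds.gammaOf_spec` («g ≤ γ(σ) ⇒ g·p(g) ≤ σ») for the
first two, and for the radius clause `CouplingWindow.hD_of_threshold` (print's (43)-radius against the scale factor `(L^jη)²`, with the
collar profile bounded by `LargeFieldStd.rcolOf_le`: `Rcol j ≤ (R₁+1)M₁·x(g_j)^{r₀}`) at the threshold `Thresholds.tau46` with `B₃ ↦ C68∕2`
and one level up (`k ↦ k+1`, which turns its `4L²B₃·(L^j∕L^{k+1})²` into this file's `2C68·ℓ_j²`).  Consequence: the four in-edge faces of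
gen 0 at the concrete sizes, the (α) clause and N08 by name from «DATA ∧ three faces» on the coupling window `g_k ≤ γ_loop`
(`inEdgeFaces_of_three_of_le`, `runAlpha_of_data_faces₃_of_le`).
HONEST FRAMING: count-neutral; the threshold `γ_loop` is NOT folded into the lane's `γ₀` (`Primitives.AlphaConsts.gamma0`, the exhibited
family's threshold) — that is the lane's act; until then the window `g_k ≤ γ_loop` is a displayed hypothesis beside `S.g²·S.ε₀ ≤ (min γ₀ 1)²`.
Nothing of [B10] is asserted; d = 3 lattice gauge theory on finite tori as printed; nothing about d = 4, the continuum, OS axioms, a mass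
gap or the Clay problem.
-/

noncomputable section

namespace Summit.QuantumFields.YangMills.Theorems.BalabanUVNodesN08AlphaLoop28Threshold

open scoped BigOperators
open Literature.MathematicalPhysics.QuantumFieldTheory.Balaban1983to89
open Literature.MathematicalPhysics.QuantumFieldTheory.Balaban1983to89.B10
open Literature.MathematicalPhysics.QuantumFieldTheory.Balaban1983to89.B10SectCExpansion (TermSizes)
open Literature.MathematicalPhysics.QuantumFieldTheory.Balaban1985CMP102
open Literature.MathematicalPhysics.QuantumFieldTheory.Balaban1985CMP102.Setting
open Summit.QuantumFields.Balaban3D.Carriers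
open Summit.QuantumFields.Balaban3D.Proofs.Inputs
open Summit.QuantumFields.Balaban3D.Proofs.Primitives (AlphaConsts)
open Summit.QuantumFields.Balaban3D.Proofs.GroupModelLieC (lieC)
open Summit.QuantumFields.Balaban3D.Proofs.UVStability3DInputs
open Summit.QuantumFields.Balaban3D.Proofs.ScalesArithmetic (gk_pos gk_le_one)
open Summit.QuantumFields.Balaban3D.Proofs.CouplingWindow (hD_of_threshold)
open Summit.QuantumFields.Balaban3D.Proofs.Thresholds (gammaOf gammaOf_spec gammaOf_pos_le tau46 tau46_spec)
open Summit.QuantumFields.Balaban3D.Proofs.LargeFieldStd (rcolOf_le)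
open Summit.QuantumFields.YangMills.Theorems.BalabanUVNodesN08AlphaClassI
open Summit.QuantumFields.YangMills.Theorems.BalabanUVNodesN08AlphaLoop28
open B7Prop2Explicit (C0 c2' C0_pos c2'_pos)
open B10LargeField (xlog)

variable {L : ℕ}

/-! ## §1 The threshold -/

section Threshold

variable {N : ℕ} (𝔠 : AlphaConsts L N)

/-- `σ_loop = min (1∕(3C₀(3)·C68)) (c₂′(3, L)∕(2C68))` — the target of «g·p(g) ≤ σ» for [4] Prop. 2's two smallness clauses at `α₀ =
C68·g p(g)`. [cite: Balaban1985Averaging, Prop. 2 (52)–(54) p.26] -/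
def sigmaLoop : ℝ := min (1 / (3 * C0 3 * 𝔠.C68)) (c2' 3 L / (2 * 𝔠.C68))

/-- `σ_loop > 0`. [folklore] -/
theorem sigmaLoop_pos : 0 < sigmaLoop 𝔠 := by
  have h1 := C0_pos 3
  have h2 := c2'_pos 3 L (le_of_lt 𝔠.one_lt_L)
  have h3 := 𝔠.C68_pos
  unfold sigmaLoop
  exact lt_min (by positivity) (by positivity)

/-- **`γ_loop = min (γ(σ_loop)) (τ₄₆(L, C68∕2, b₀, p₀, r₀, (R₁+1)M₁)²)`** — ONE coupling threshold for the three clauses of `LoopSmall`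
(`Thresholds.gammaOf` for [4] Prop. 2's smallness, `Thresholds.tau46` for the (43)-radius clause of the logarithm (28)).
[cite: Balaban1985UV3, p.267 L7–8 + (43) p.266] -/
def gammaLoop : ℝ :=
  min (gammaOf 𝔠.b₀ 𝔠.p₀ (sigmaLoop 𝔠)) (tau46 L (𝔠.C68 / 2) 𝔠.b₀ 𝔠.p₀ 𝔠.r₀ ((𝔠.R₁ + 1) * 𝔠.M₁) ^ 2)

/-- `0 < γ_loop ≤ 1`. [folklore] -/
theorem gammaLoop_pos_le : 0 < gammaLoop 𝔠 ∧ gammaLoop 𝔠 ≤ 1 := by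
  have h1 := gammaOf_pos_le 𝔠.b₀_pos 𝔠.p₀_pos (sigmaLoop_pos 𝔠)
  have hRM : 0 ≤ (𝔠.R₁ + 1) * (𝔠.M₁ : ℝ) := by have := 𝔠.R₁_nonneg; positivity
  have h2 := (tau46_spec (le_of_lt 𝔠.one_lt_L) (half_pos 𝔠.C68_pos) 𝔠.b₀_pos 𝔠.p₀_pos (le_trans zero_le_one 𝔠.one_le_r₀) hRM).1
  unfold gammaLoop
  exact ⟨lt_min h1.1 (by positivity), (min_le_left _ _).trans h1.2⟩

end Threshold

/-! ## §2 `LoopSmall` from the threshold -/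

section Small

variable {S : Scales L} {G : Type} [GaugeGroup G] [MeasurableSpace G] [HaarData G] (𝔊 : GroupModel G) (𝔠 : AlphaConsts L 𝔊.N)
  (X : ExternalInputs S G)

omit [HaarData G] in
/-- **«FOR g_{k−1} SUFFICIENTLY SMALL» AS ONE THRESHOLD**: if `g_k ≤ γ_loop` for every `k < K`, the three displayed smallness clauses
`LoopSmall 𝔊 𝔠` of `loop28_of_reg2` hold — [4] Prop. 2's `C₀α₀ ≤ ⅓`, `2α₀ ≤ c₂′` by `Thresholds.gammaOf_spec`, and the radius clause
`Rcol j · 2C68 g_kp(g_k)ℓ_j² ≤ ½`, `1 ≤ j ≤ k`, by `CouplingWindow.hD_of_threshold` one level up (`k ↦ k+1`, `B₃ ↦ C68∕2`, radii bounded by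
`LargeFieldStd.rcolOf_le`). [cite: Balaban1985UV3, p.267 L7–8 + (43)–(44) pp.266–267] -/
theorem loopSmall_of_le_gammaLoop (hγ : ∀ k, k + 1 ≤ S.K → S.gk k ≤ gammaLoop 𝔠) : LoopSmall 𝔊 𝔠 (S := S) := by
  have hL1 : 1 ≤ L := le_of_lt 𝔠.one_lt_L
  have hL2 : 2 ≤ L := 𝔠.one_lt_L
  have hLr : (0 : ℝ) < L := by exact_mod_cast lt_of_lt_of_le zero_lt_one hL1
  have hC0 := C0_pos 3
  have hC68 := 𝔠.C68_pos
  have hr₀ : 0 ≤ 𝔠.r₀ := le_trans zero_le_one 𝔠.one_le_r₀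
  have hRM : 0 ≤ (𝔠.R₁ + 1) * (𝔠.M₁ : ℝ) := by have := 𝔠.R₁_nonneg; positivity
  -- g_k p(g_k) ≤ σ_loop on the window
  have hσ : ∀ k, k + 1 ≤ S.K → S.gk k * pFun 𝔠.b₀ 𝔠.p₀ (S.gk k) ≤ sigmaLoop 𝔠 := fun k hk =>
    gammaOf_spec 𝔠.b₀_pos 𝔠.p₀_pos (sigmaLoop_pos 𝔠).le (gk_pos S k) ((hγ k hk).trans (min_le_left _ _))
  refine ⟨fun k hk => ?_, fun k hk => ?_, fun k hk j hj => ?_⟩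
  · -- C₀·(C68·g p(g)) ≤ C₀·C68·σ_loop ≤ ⅓
    have h := hσ k hk
    have h1 : sigmaLoop 𝔠 ≤ 1 / (3 * C0 3 * 𝔠.C68) := min_le_left _ _
    show C0 3 * (𝔠.C68 * (S.gk k * pFun 𝔠.b₀ 𝔠.p₀ (S.gk k))) ≤ 1 / 3
    calc C0 3 * (𝔠.C68 * (S.gk k * pFun 𝔠.b₀ 𝔠.p₀ (S.gk k))) ≤ C0 3 * (𝔠.C68 * (1 / (3 * C0 3 * 𝔠.C68))) := by
          gcongr; exact h.trans h1
      _ = 1 / 3 := by field_simp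
  · have h := hσ k hk
    have h1 : sigmaLoop 𝔠 ≤ c2' 3 L / (2 * 𝔠.C68) := min_le_right _ _
    show 2 * (𝔠.C68 * (S.gk k * pFun 𝔠.b₀ 𝔠.p₀ (S.gk k))) ≤ c2' 3 L
    calc 2 * (𝔠.C68 * (S.gk k * pFun 𝔠.b₀ 𝔠.p₀ (S.gk k))) ≤ 2 * (𝔠.C68 * (c2' 3 L / (2 * 𝔠.C68))) := by
          gcongr; exact h.trans h1
      _ = c2' 3 L := by field_simp
  · -- the radius clause, `hD_of_threshold` at level k+1 with B₃ := C68/2, radii D := Rcol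
    set τ : ℝ := tau46 L (𝔠.C68 / 2) 𝔠.b₀ 𝔠.p₀ 𝔠.r₀ ((𝔠.R₁ + 1) * 𝔠.M₁) with hτ_def
    obtain ⟨hτ0, hsmall⟩ := tau46_spec hL1 (half_pos hC68) 𝔠.b₀_pos 𝔠.p₀_pos hr₀ hRM
    have hgτ : Real.sqrt (S.gk (k + 1 - 1)) ≤ τ := by
      rw [Nat.add_sub_cancel, show τ = Real.sqrt (τ ^ 2) from (Real.sqrt_sq hτ0.le).symm]
      exact Real.sqrt_le_sqrt ((hγ k hk).trans (min_le_right _ _))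
    have hDle : ∀ i ∈ Finset.Icc 1 (k + 1),
        (rcolOf S 𝔠.lane.carrier i : ℝ) ≤ (𝔠.R₁ + 1) * 𝔠.M₁ * xlog (S.gk i) ^ 𝔠.r₀ + 1 := fun i hi => by
      have hiK : i ≤ S.K := (Finset.mem_Icc.1 hi).2.trans hk
      have h := rcolOf_le (S := S) 𝔠.lane.carrier 𝔠.R₁_nonneg hr₀ i hiK
      exact h.trans (by show (𝔠.R₁ + 1) * (𝔠.M₁ : ℝ) * xlog (S.gk i) ^ 𝔠.r₀ ≤ _; linarith)
    have key := hD_of_threshold L hL2 S.g_pos S.ε_pos 𝔠.b₀_pos.le 𝔠.p₀_pos hr₀ hRM (half_pos hC68).le S.gk (fun _ => rfl)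
      (k := k + 1) (by omega) (gk_le_one S S.gK_le_one (k + 1) hk) hgτ hsmall (rcolOf S 𝔠.lane.carrier) hDle j
      (Finset.mem_Icc.2 ⟨(Finset.mem_Icc.1 hj).1, (Finset.mem_Icc.1 hj).2.trans (Nat.le_succ k)⟩)
    rw [Nat.add_sub_cancel] at key
    -- (L^j/L^{k+1})² = L⁻²·ℓ_j²
    have hjk : j ≤ k := (Finset.mem_Icc.1 hj).2
    have hsc : (L : ℝ) ^ j * ((L : ℝ) ^ (k + 1))⁻¹ = (L : ℝ)⁻¹ * ell S.P k j := by
      rw [← scale_eq_ell (S := S) hjk, pow_succ, mul_inv]; ring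
    rw [hsc] at key
    have hL2r : (L : ℝ) ^ 2 ≠ 0 := pow_ne_zero 2 hLr.ne'
    calc (rcolOf S 𝔠.lane.carrier j : ℝ) * (2 * (𝔠.C68 * (S.gk k * pFun 𝔠.b₀ 𝔠.p₀ (S.gk k))) * ell S.P k j ^ 2)
        = (rcolOf S 𝔠.lane.carrier j : ℝ) * (4 * (L : ℝ) ^ 2 * (𝔠.C68 / 2) * (S.gk k * pFun 𝔠.b₀ 𝔠.p₀ (S.gk k)) *
            ((L : ℝ)⁻¹ * ell S.P k j) ^ 2) := by field_simp; ring
      _ ≤ 1 / 2 := key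

/-- **GEN 0'S FOUR FACES AT THE CONCRETE SIZES FROM THE THREE, ON THE COUPLING WINDOW `g_k ≤ γ_loop`** (+ `C68 ≤ 2L²B₃`).
[cite: Balaban1985UV3, (44) p.267] -/
theorem inEdgeFaces_of_three_of_le
    (coef : (k : ℕ) → Hist S.P (k + 1) → GaugeField S.P (k + 1) G → (j : ℕ) → TermSizes (oldGeom S.P k j))
    (F : InEdgeFaces₃ 𝔊 𝔠 X) (hγ : ∀ k, k + 1 ≤ S.K → S.gk k ≤ gammaLoop 𝔠) (hC68 : 𝔠.C68 ≤ 2 * (L : ℝ) ^ 2 * 𝔠.B₃) :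
    InEdgeFaces 𝔊 𝔠 X (sizesOf 𝔊 𝔠 X coef) :=
  inEdgeFaces_of_three 𝔊 𝔠 X coef F (loopSmall_of_le_gammaLoop 𝔊 𝔠 hγ) hC68

variable (𝔖 : ∀ k, StepSeries S G ↥(lieC 𝔊) (nblkOf S 𝔠.lane.carrier k) k) (𝔄 : AlphaData 𝔊 𝔠 X 𝔖)

/-- **THE (α) CLAUSE FROM «DATA ∧ (43)-FORM AT THE CONCRETE SIZES ∧ THREE FACES» ON THE COUPLING WINDOW `g_k ≤ γ_loop`** (+ `C68 ≤ 2L²B₃`).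
[cite: Balaban1985UV3, (41) p.266 + (44) p.267 + (47) p.267] -/
theorem runAlpha_of_data_faces₃_of_le
    (coef : (k : ℕ) → Hist S.P (k + 1) → GaugeField S.P (k + 1) G → (j : ℕ) → TermSizes (oldGeom S.P k j))
    (D : RunDataRows 𝔊 𝔠 X 𝔖 𝔄 (sizesOf 𝔊 𝔠 X coef)) (F : InEdgeFaces₃ 𝔊 𝔠 X)
    (hγ : ∀ k, k + 1 ≤ S.K → S.gk k ≤ gammaLoop 𝔠) (hC68 : 𝔠.C68 ≤ 2 * (L : ℝ) ^ 2 * 𝔠.B₃) : RunAlpha 𝔊 𝔠 X 𝔖 𝔄 :=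
  runAlpha_of_data_faces₃ 𝔊 𝔠 X 𝔖 𝔄 coef D F (loopSmall_of_le_gammaLoop 𝔊 𝔠 hγ) hC68

end Small

/-! ## §3 N08 by name on the coupling window (through `BalabanUVNodesN08AlphaLoop28` §5) -/

section N08

open Literature.MathematicalPhysics.QuantumFieldTheory.Balaban1983to89.DagBinding (leavesP WorldP PrintedCarriersR PrintedCarriers9X
  PrintedCarriers11 PrintedCarriers14R PrintedCarriers15)
open Literature.MathematicalPhysics.QuantumFieldTheory.Balaban1983to89.B10CompactBinding (ofPrintedAllXPNC)
open Summit.QuantumFields.Balaban3D.Proofs.FamilyLE (ScalesLE)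

variable {G : Type} [GaugeGroup G] [MeasurableSpace G] [HaarData G] {𝔊 : GroupModel G} {𝔠 : AlphaConsts L 𝔊.N}
  {X : ∀ S : Scales L, ExternalInputs S G}
  {𝔖 : ∀ (S : Scales L) (k : ℕ), StepSeries S G ↥(lieC 𝔊) (nblkOf S 𝔠.lane.carrier k) k}
  {𝔄 : ∀ S : Scales L, AlphaData 𝔊 𝔠 (X S) (𝔖 S)}
  {coef : ∀ (S : Scales L) (k : ℕ), Hist S.P (k + 1) → GaugeField S.P (k + 1) G → (j : ℕ) → TermSizes (oldGeom S.P k j)}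
  {Xc : PrintedCarriersR} {Y : PrintedCarriers9X} {Z : PrintedCarriers11} {V : PrintedCarriers14R} {W : PrintedCarriers15}
  {w : WorldP} {P : B12.RunParams}

/-- **N08 BY NAME AT THE C-BINDING OF RECORD OVER THE CONSTRUCTED RUN FAMILY, from the DATA (at the concrete sizes) and the THREE faces, ON THE
COUPLING WINDOW `g_k ≤ γ_loop`** of each approximation of the `≤`-family (+ `C68 ≤ 2L²B₃`): `Dag.B10_main (leavesP w P)` at the C-binding pin
(`BalabanUVNodesN08AlphaLoop28.b10_main_constructedLE_upC_of_faces₃` ∘ `loopSmall_of_le_gammaLoop`). [cite: Balaban1985UV3, Thm 1 p.257 (compact reading) + Thm 2 p.272] -/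
theorem b10_main_constructedLE_upC_of_faces₃_of_le
    (hD : ∀ S : Scales L, S.g ^ 2 * S.ε₀ ≤ (min 𝔠.gamma0 1) ^ 2 → RunDataRows 𝔊 𝔠 (X S) (𝔖 S) (𝔄 S) (sizesOf 𝔊 𝔠 (X S) (coef S)))
    (hF : ∀ S : Scales L, S.g ^ 2 * S.ε₀ ≤ (min 𝔠.gamma0 1) ^ 2 → InEdgeFaces₃ 𝔊 𝔠 (X S))
    (hγ : ∀ S : Scales L, S.g ^ 2 * S.ε₀ ≤ (min 𝔠.gamma0 1) ^ 2 → ∀ k, k + 1 ≤ S.K → S.gk k ≤ gammaLoop 𝔠)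
    (hC68 : 𝔠.C68 ≤ 2 * (L : ℝ) ^ 2 * 𝔠.B₃)
    (hup : w.up P = ofPrintedAllXPNC (Xc.withTowerRuns10 fun S : ScalesLE L ((min 𝔠.gamma0 1) ^ 2) =>
      towerOf 𝔠.lane (X S.1) (𝔖 S.1)) Y Z V W) :
    Dag.B10_main (leavesP w P) :=
  b10_main_constructedLE_upC_of_faces₃ hD hF (fun S hS => loopSmall_of_le_gammaLoop 𝔊 𝔠 (hγ S hS)) hC68 hup

end N08

/-! ## §4 (v1.1) The (43)-form at the concrete sizes: the clause «loop sizes are sizes» is a theorem -/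

section Form43

open Literature.MathematicalPhysics.QuantumFieldTheory.Balaban1983to89.B10SectCExpansion (Shape43)

variable {S : Scales L} {G : Type} [GaugeGroup G] [MeasurableSpace G] [HaarData G] (𝔊 : GroupModel G) (𝔠 : AlphaConsts L 𝔊.N)
  (X : ExternalInputs S G) (𝔖 : ∀ k, StepSeries S G ↥(lieC 𝔊) (nblkOf S 𝔠.lane.carrier k) k)

/-- **THE (43)-FORM AT THE CONCRETE SIZES FROM ITS TWO PRINTED CLAUSES** (v1.1): gen 0's `OldTermForm 𝔊 𝔠 𝔖 𝔏 k` at `𝔏 := sizesOf 𝔊 𝔠 X coef`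
from (43)'s coefficient shape (`Shape43`: decay + the degree floor «n ≥ 2») and the multilinear evaluation bound `|𝒫_j(Y_j, U_{k+1})| ≤
|𝒫_j(Y_j)|·Π_i|B_{k+1}(c_i)|` alone — its third clause `loop_nonneg` («loop sizes are sizes») HOLDS for the concrete sizes
(`BalabanUVNodesN08AlphaLoop28.loopOf_nonneg`).  So the DATA displayed at the concrete sizes is exactly: `StepDataRows` per step, `Shape43` of
the coefficient sizes, and `mult43`. [cite: Balaban1985UV3, (43) p.266] -/
theorem oldTermForm_sizesOf_of_shape_mult
    (coef : (k : ℕ) → Hist S.P (k + 1) → GaugeField S.P (k + 1) G → (j : ℕ) → TermSizes (oldGeom S.P k j)) (k : ℕ)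
    (hshape : ∀ (h : Hist S.P (k + 1)) (U : GaugeField S.P (k + 1) G), ∀ j ∈ Finset.Icc 1 k,
      Shape43 (oldGeom S.P k j) (coef k h U j) 𝔠.κ₁ (𝔠.M₁ : ℝ) (ell S.P k j) 𝔠.C44)
    (hmult : ∀ (h : Hist S.P (k + 1)) (U : GaugeField S.P (k + 1) G), ∀ j ∈ Finset.Icc 1 k,
      ∀ (y : Site S.P j) (n : ℕ) (c : Fin n → PBond S.P j),
        |(𝔖 k).oldVal h U j y n c| ≤ |coef k h U j y n c| * ∏ i, loopOf 𝔊 𝔠 X k h U j y (c i)) :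
    OldTermForm 𝔊 𝔠 𝔖 (sizesOf 𝔊 𝔠 X coef) k where
  shape43 := hshape
  loop_nonneg h U j _ y b := loopOf_nonneg 𝔊 𝔠 X k h U j y b
  mult43 := hmult

end Form43

end Summit.QuantumFields.YangMills.Theorems.BalabanUVNodesN08AlphaLoop28Threshold

end
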